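import Mathlib
import HarnessLib

/-!
# The fixed-determinant local obstruction table at `p = 2`
(crux `TwoAdicBianchiProModularityLevel`, stmt-Langlands-15110; line `SketchIdeator6`, card
`two-adic-block-trichotomy`, table A2 — kernel-checked in full)

For a place `v ∣ 2` of a `2`-split imaginary quadratic field `K` (so `K_v = ℚ₂`) and a residual
local representation `σ̄_v : G_{ℚ₂} → GL₂(𝔽)`, `𝔽 ⊇ 𝔽₄` of characteristic `2`, the obstruction
space of the fixed-determinant framed deformation functor is `H²(G_{ℚ₂}, sl₂) ≅ H⁰(G_{ℚ₂}, pgl₂)^∨`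
(local Tate duality; the mod-`2` cyclotomic character is trivial and the trace pairing identifies
`sl₂^∨` with `pgl₂ := gl₂ / scalars`, which at `p = 2` is NOT `sl₂`: the scalars are trace-free).
A class `[X] ∈ pgl₂(𝔽)` is invariant under the decomposition group iff `g X g⁻¹ − X` is scalar for
every `g` in the local image, i.e. iff `g X = X g + c_g • g` (inverse-free form).  The local image
acts through its projective image `D̄_v ≤ A₅ ≅ SL₂(𝔽₄)`, and the subgroups of `SL₂(𝔽₄)` that occur
as `Gal(L/ℚ₂)` are, up to conjugacy, `1`, `C₂ = ⟨u₁⟩`, `V₄ = ⟨u₁, u_ω⟩`, `C₃ = ⟨t⟩`, `C₅ = ⟨s⟩`,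
`S₃ = ⟨u₁, w⟩ = SL₂(𝔽₂)` and `A₄ = ⟨u₁, u_ω, t⟩ = B(𝔽₄)` (the Borel subgroup), where
`u₁ = !![1,1;0,1]`, `u_ω = !![1,ω;0,1]`, `t = !![ω,0;0,ω+1]`, `s = !![0,1;1,ω]`, `w = !![0,1;1,0]`
and `ω² + ω + 1 = 0`.

Over ANY field `F` of characteristic `2` containing such an `ω` (e.g. `𝔽₄ ⊆ 𝔽 ⊆ 𝔽̄₂`) this file
computes the exact space of solutions `X = !![x,y;z,w] ∈ M₂(F)` of the projective-invariance
equations for each type, as `iff` statements (so both inclusions are kernel facts):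

| type `D̄_v` | solutions                        | dim | `h⁰(pgl₂) = h²(G_v, sl₂) = dim − 1` |
|-------------|----------------------------------|-----|--------------------------------------|
| `1`         | all `X`                          | 4   | 3                                    |
| `C₂`        | `w = x + z`                      | 3   | 2                                    |
| `V₄`        | `z = 0, w = x`                   | 2   | 1                                    |
| `C₃`        | `y = 0, z = 0`                   | 2   | 1                                    |
| `C₅`        | `z = y, w = x + ω y`             | 2   | 1                                    |
| `S₃`        | `z = y, w = x + y`               | 2   | 1                                    |
| `A₄`        | `y = 0, z = 0, w = x` (scalars)  | 1   | 0                                    |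

For every type other than `A₄` an explicit NON-SCALAR projective invariant is exhibited, and for `A₄`
the invariants are the scalars (`borelF4_projInvariants_scalar`, the first lemma of the card).
Consequence recorded by the card: `A₄` (in characteristic `0`: Weil's primitive `2`-adic
tetrahedral type, which exists only at `p = 2`) is the UNIQUE realisable local type at `v ∣ 2` whose
unrestricted fixed-determinant framed deformation ring is formally smooth — Gee–Newton's regularity
hypothesis [GeeNewton2020, Lemma 49, Rem. 53] — while `h² ≥ 1` on every other type.  Also recorded:
the identity matrix is trace-free in characteristic `2` (`trace_one_fin_two_eq_zero`), so
`H⁰(sl₂) ∋ 1` and the `PGL₂`-valued functor (`H²(pgl₂) = H⁰(sl₂)^∨`) is obstructed for EVERY type;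
one must work with `GL₂` and fixed determinant, as [Kisin2009TwoAdic] does.  The orders of the
generators `t` (`3`) and `s` (`5`) are certified (`splitTorus_pow_three`, `nonsplitTorus_pow_five`).

Pure linear algebra over `F` (Mathlib only); nothing about the crux is restated.
-/

set_option linter.dupNamespace false -- `Summit.Langlands.Langlands` is the mandated namespace (D-0017)

namespace Summit.Langlands.Langlands.Theorems.TwoAdicBianchiProModularityLevel

section LocalObstructionTable

variable {F : Type*}

/-! ### Bookkeeping: entrywise forms -/

/-- Two `2 × 2` matrices written with `!![…]` are equal iff their four entries are. [folklore] -/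
theorem fin_two_eq_iff (a b c d a' b' c' d' : F) :
    !![a, b; c, d] = !![a', b'; c', d'] ↔ (a = a' ∧ b = b') ∧ (c = c' ∧ d = d') := by
  rw [← Matrix.ext_iff, Fin.forall_fin_two, Fin.forall_fin_two, Fin.forall_fin_two]
  simp only [Matrix.of_apply, Matrix.cons_val', Matrix.cons_val_zero, Matrix.cons_val_one,
    Matrix.empty_val', Matrix.cons_val_fin_one]

variable [Field F]

/-- Entrywise form of the projective-commutation equation `g X = X g + e • g` ("`g X g⁻¹ ≡ X`
modulo scalars", inverse-free) for `2 × 2` matrices. [folklore] -/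
theorem fin_two_mul_eq_mul_add_smul_iff (a b c d x y z w e : F) :
    !![a, b; c, d] * !![x, y; z, w] = !![x, y; z, w] * !![a, b; c, d] + e • !![a, b; c, d] ↔
      (a * x + b * z = x * a + y * c + e * a ∧ a * y + b * w = x * b + y * d + e * b) ∧
        (c * x + d * z = z * a + w * c + e * c ∧ c * y + d * w = z * b + w * d + e * d) := by
  rw [Matrix.mul_fin_two, Matrix.mul_fin_two]
  simp only [Matrix.smul_of, Matrix.smul_cons, smul_eq_mul, Matrix.smul_empty, Matrix.of_add_of,
    Matrix.cons_add_cons, Matrix.empty_add_empty, fin_two_eq_iff]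

/-- A matrix with a non-zero off-diagonal entry, or with distinct diagonal entries, is not scalar.
[folklore] -/
theorem not_exists_eq_smul_one {X : Matrix (Fin 2) (Fin 2) F}
    (h : X 0 1 ≠ 0 ∨ X 0 0 ≠ X 1 1) : ¬ ∃ c : F, X = c • (1 : Matrix (Fin 2) (Fin 2) F) := by
  rintro ⟨c, rfl⟩
  rcases h with h | h
  · exact h (by simp [Matrix.one_apply_ne (show (0 : Fin 2) ≠ 1 by decide)])
  · exact h (by simp)

/-- **Type `C₃`** (`D̄_v = ⟨t⟩`, `t = !![ω,0;0,ω+1]` the split torus; block (ii), in characteristic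
`0` the `2`-distinguished ordinary type).  The projective invariants of `t` are exactly the DIAGONAL
matrices — a `2`-dimensional space, so `h⁰(⟨t⟩, pgl₂) = 1` (no hypothesis on `ω` or on the
characteristic is needed for this entry). [folklore] -/
theorem projComm_splitTorus_iff (ω : F) (X : Matrix (Fin 2) (Fin 2) F) :
    (∃ c : F, !![ω, 0; 0, ω + 1] * X = X * !![ω, 0; 0, ω + 1] + c • !![ω, 0; 0, ω + 1]) ↔
      X 0 1 = 0 ∧ X 1 0 = 0 := by
  obtain ⟨x, y, z, w, rfl⟩ : ∃ x y z w : F, X = !![x, y; z, w] := ⟨_, _, _, _, Matrix.eta_fin_two X⟩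
  simp only [fin_two_mul_eq_mul_add_smul_iff, Matrix.of_apply, Matrix.cons_val',
    Matrix.cons_val_zero, Matrix.cons_val_one, Matrix.empty_val', Matrix.cons_val_fin_one]
  constructor
  · rintro ⟨e, ⟨-, a01⟩, a10, -⟩
    exact ⟨by linear_combination -a01, by linear_combination a10⟩
  · rintro ⟨hy, hz⟩
    refine ⟨0, ⟨?_, ?_⟩, ?_, ?_⟩
    · ring
    · linear_combination -hy
    · linear_combination hz
    · ring

/-- A non-scalar projective invariant of type `C₃`: `t` itself (diagonal with `ω ≠ ω + 1`); so
`h⁰(⟨t⟩, pgl₂) = 1`, not `0`. [folklore] -/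
theorem exists_nonscalar_projComm_splitTorus (ω : F) :
    ∃ X : Matrix (Fin 2) (Fin 2) F,
      (∃ c : F, !![ω, 0; 0, ω + 1] * X = X * !![ω, 0; 0, ω + 1] + c • !![ω, 0; 0, ω + 1]) ∧
        ¬ ∃ c : F, X = c • (1 : Matrix (Fin 2) (Fin 2) F) :=
  ⟨!![ω, 0; 0, ω + 1], (projComm_splitTorus_iff ω _).2 (by simp),
    not_exists_eq_smul_one (Or.inr (by simp))⟩

/-- Conversely every scalar matrix is a projective invariant of any `g` (with `c = 0`), so the
`A₄` entry of the table is exactly the line of scalars: `h⁰ = 1 − 1 = 0`. [folklore] -/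
theorem projComm_smul_one (g : Matrix (Fin 2) (Fin 2) F) (a : F) :
    ∃ c : F, g * (a • (1 : Matrix (Fin 2) (Fin 2) F)) = (a • (1 : Matrix (Fin 2) (Fin 2) F)) * g +
      c • g :=
  ⟨0, by simp⟩

/-! ### The cube root of unity (characteristic `2` from here on) -/

variable [CharP F 2]

/-- In characteristic `2`, `ω² + ω + 1 = 0` gives `ω (ω + 1) = 1`. [folklore] -/
theorem omega_mul_omega_add_one {ω : F} (hω : ω ^ 2 + ω + 1 = 0) : ω * (ω + 1) = 1 := by
  have h2 : (2 : F) = 0 := CharTwo.two_eq_zero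
  linear_combination hω - h2

/-- In characteristic `2`, a root of `X² + X + 1` is non-zero. [folklore] -/
theorem omega_ne_zero {ω : F} (hω : ω ^ 2 + ω + 1 = 0) : ω ≠ 0 := by
  intro h
  have := omega_mul_omega_add_one hω
  rw [h, zero_mul] at this
  exact zero_ne_one this

/-- In characteristic `2`, a root `ω` of `X² + X + 1` has `ω + 1 ≠ 0` (i.e. `ω ∉ 𝔽₂`). [folklore] -/
theorem omega_add_one_ne_zero {ω : F} (hω : ω ^ 2 + ω + 1 = 0) : ω + 1 ≠ 0 := by
  intro h
  have := omega_mul_omega_add_one hω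
  rw [h, mul_zero] at this
  exact zero_ne_one this

/-- The identity of `M₂(F)` is trace-free in characteristic `2`: the scalars lie in `sl₂`, so
`H⁰(sl₂) ≠ 0` for every local image and the `PGL₂`-valued deformation functor is always obstructed
at `p = 2` (`H²(pgl₂) ≅ H⁰(sl₂)^∨`). [folklore] -/
theorem trace_one_fin_two_eq_zero : Matrix.trace (1 : Matrix (Fin 2) (Fin 2) F) = 0 := by
  rw [Matrix.trace_one, Fintype.card_fin]
  exact CharTwo.two_eq_zero

/-- The split-torus generator `t = diag(ω, ω + 1) = diag(ω, ω⁻¹)` has order dividing `3`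
(type `C₃`). [folklore] -/
theorem splitTorus_pow_three {ω : F} (hω : ω ^ 2 + ω + 1 = 0) :
    !![ω, 0; 0, ω + 1] ^ 3 = (1 : Matrix (Fin 2) (Fin 2) F) := by
  have h2 : (2 : F) = 0 := CharTwo.two_eq_zero
  simp only [pow_succ, pow_zero, Matrix.mul_fin_two, Matrix.one_fin_two, fin_two_eq_iff]
  refine ⟨⟨?_, ?_⟩, ?_, ?_⟩
  · linear_combination (ω - 1) * hω
  · ring
  · ring
  · linear_combination (ω + 2) * hω + (-1 : F) * h2

/-- The non-split-torus generator `s = !![0,1;1,ω]` (characteristic polynomial `X² + ωX + 1`,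
irreducible over `𝔽₄`) satisfies `s⁵ = 1` (type `C₅`). [folklore] -/
theorem nonsplitTorus_pow_five {ω : F} (hω : ω ^ 2 + ω + 1 = 0) :
    !![(0 : F), 1; 1, ω] ^ 5 = (1 : Matrix (Fin 2) (Fin 2) F) := by
  have h2 : (2 : F) = 0 := CharTwo.two_eq_zero
  simp only [pow_succ, pow_zero, Matrix.mul_fin_two, Matrix.one_fin_two, fin_two_eq_iff]
  refine ⟨⟨?_, ?_⟩, ?_, ?_⟩
  · linear_combination (ω - 1) * hω + ω * h2
  · linear_combination (ω ^ 2 - ω + 3) * hω + (-ω - 1) * h2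
  · linear_combination (ω ^ 2 - ω + 3) * hω + (-ω - 1) * h2
  · linear_combination (ω ^ 3 - ω ^ 2 + 4 * ω - 3) * hω + (ω + 1) * h2

/-! ### The table, type by type -/

/-- **Type `C₂`** (`D̄_v = ⟨u₁⟩`, `u₁ = !![1,1;0,1]`; Paškūnas block (iv)).  The projective
invariants of `u₁` on `M₂(F)` are exactly the `X` with `X₁₁ = X₀₀ + X₁₀` — a `3`-dimensional space,
so `h⁰(⟨u₁⟩, pgl₂) = 2`. [folklore] -/
theorem projComm_unipotent_iff (X : Matrix (Fin 2) (Fin 2) F) :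
    (∃ c : F, !![(1 : F), 1; 0, 1] * X = X * !![(1 : F), 1; 0, 1] + c • !![(1 : F), 1; 0, 1]) ↔
      X 1 1 = X 0 0 + X 1 0 := by
  have h2 : (2 : F) = 0 := CharTwo.two_eq_zero
  obtain ⟨x, y, z, w, rfl⟩ : ∃ x y z w : F, X = !![x, y; z, w] := ⟨_, _, _, _, Matrix.eta_fin_two X⟩
  simp only [fin_two_mul_eq_mul_add_smul_iff, Matrix.of_apply, Matrix.cons_val',
    Matrix.cons_val_zero, Matrix.cons_val_one, Matrix.empty_val', Matrix.cons_val_fin_one]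
  constructor
  · rintro ⟨e, ⟨a00, a01⟩, -, -⟩
    linear_combination a01 - a00
  · intro h
    refine ⟨z, ⟨?_, ?_⟩, ?_, ?_⟩
    · ring
    · linear_combination h
    · ring
    · linear_combination (-z) * h2

/-- A non-scalar projective invariant of type `C₂`: `X = !![0,1;0,0]`; so `h⁰(⟨u₁⟩, pgl₂) ≥ 1`
(in fact `= 2`). [folklore] -/
theorem exists_nonscalar_projComm_unipotent :
    ∃ X : Matrix (Fin 2) (Fin 2) F,
      (∃ c : F, !![(1 : F), 1; 0, 1] * X = X * !![(1 : F), 1; 0, 1] + c • !![(1 : F), 1; 0, 1]) ∧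
        ¬ ∃ c : F, X = c • (1 : Matrix (Fin 2) (Fin 2) F) :=
  ⟨!![0, 1; 0, 0], (projComm_unipotent_iff _).2 (by simp),
    not_exists_eq_smul_one (Or.inl (by simp))⟩

/-- **Type `V₄`** (`D̄_v = ⟨u₁, u_ω⟩`, the unipotent radical of the Borel; block (iv)).  The joint
projective invariants are exactly the `X` with `X₁₀ = 0` and `X₁₁ = X₀₀` — a `2`-dimensional space,
so `h⁰(V₄, pgl₂) = 1`. [folklore] -/
theorem projComm_kleinFour_iff {ω : F} (hω : ω ^ 2 + ω + 1 = 0) (X : Matrix (Fin 2) (Fin 2) F) :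
    ((∃ c : F, !![(1 : F), 1; 0, 1] * X = X * !![(1 : F), 1; 0, 1] + c • !![(1 : F), 1; 0, 1]) ∧
      (∃ c : F, !![(1 : F), ω; 0, 1] * X = X * !![(1 : F), ω; 0, 1] + c • !![(1 : F), ω; 0, 1])) ↔
      X 1 0 = 0 ∧ X 1 1 = X 0 0 := by
  have h2 : (2 : F) = 0 := CharTwo.two_eq_zero
  have hω0 := omega_ne_zero hω
  have hω1 := omega_add_one_ne_zero hω
  obtain ⟨x, y, z, w, rfl⟩ : ∃ x y z w : F, X = !![x, y; z, w] := ⟨_, _, _, _, Matrix.eta_fin_two X⟩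
  simp only [fin_two_mul_eq_mul_add_smul_iff, Matrix.of_apply, Matrix.cons_val',
    Matrix.cons_val_zero, Matrix.cons_val_one, Matrix.empty_val', Matrix.cons_val_fin_one]
  constructor
  · rintro ⟨⟨e₁, ⟨a00, a01⟩, -, -⟩, ⟨e₂, ⟨b00, b01⟩, -, -⟩⟩
    have key : ω * (ω + 1) * z = 0 := by
      linear_combination -b01 + ω * b00 + ω * a01 - ω * a00 + (ω * z) * h2
    have hz : z = 0 := by
      rcases mul_eq_zero.mp key with h | h
      · rcases mul_eq_zero.mp h with h' | h'
        · exact absurd h' hω0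
        · exact absurd h' hω1
      · exact h
    exact ⟨hz, by linear_combination a01 - a00 + hz⟩
  · rintro ⟨hz, hw⟩
    refine ⟨⟨0, ⟨?_, ?_⟩, ?_, ?_⟩, ⟨0, ⟨?_, ?_⟩, ?_, ?_⟩⟩
    · linear_combination hz
    · linear_combination hw
    · ring
    · linear_combination -hz
    · linear_combination ω * hz
    · linear_combination ω * hw
    · ring
    · linear_combination (-ω) * hz

/-- A non-scalar projective invariant of type `V₄`: `X = !![0,1;0,0]` (so `h⁰(V₄, pgl₂) = 1`, not
`0`). [folklore] -/
theorem exists_nonscalar_projComm_kleinFour {ω : F} (hω : ω ^ 2 + ω + 1 = 0) :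
    ∃ X : Matrix (Fin 2) (Fin 2) F,
      ((∃ c : F, !![(1 : F), 1; 0, 1] * X = X * !![(1 : F), 1; 0, 1] + c • !![(1 : F), 1; 0, 1]) ∧
        (∃ c : F, !![(1 : F), ω; 0, 1] * X = X * !![(1 : F), ω; 0, 1] + c • !![(1 : F), ω; 0, 1])) ∧
        ¬ ∃ c : F, X = c • (1 : Matrix (Fin 2) (Fin 2) F) :=
  ⟨!![0, 1; 0, 0], (projComm_kleinFour_iff hω _).2 (by simp),
    not_exists_eq_smul_one (Or.inl (by simp))⟩

/-- **Type `C₅`** (`D̄_v = ⟨s⟩`, `s = !![0,1;1,ω]` a non-split torus of order `5`; block (ii),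
unramified `2`-distinguished ordinary in characteristic `0`).  The projective invariants of `s` are
exactly `F[s] = {!![x, y; y, x + ω y]}` — a `2`-dimensional space, so `h⁰(⟨s⟩, pgl₂) = 1`.
[folklore] -/
theorem projComm_nonsplitTorus_iff {ω : F} (hω : ω ^ 2 + ω + 1 = 0)
    (X : Matrix (Fin 2) (Fin 2) F) :
    (∃ c : F, !![(0 : F), 1; 1, ω] * X = X * !![(0 : F), 1; 1, ω] + c • !![(0 : F), 1; 1, ω]) ↔
      X 1 0 = X 0 1 ∧ X 1 1 = X 0 0 + ω * X 0 1 := by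
  have hω0 := omega_ne_zero hω
  obtain ⟨x, y, z, w, rfl⟩ : ∃ x y z w : F, X = !![x, y; z, w] := ⟨_, _, _, _, Matrix.eta_fin_two X⟩
  simp only [fin_two_mul_eq_mul_add_smul_iff, Matrix.of_apply, Matrix.cons_val',
    Matrix.cons_val_zero, Matrix.cons_val_one, Matrix.empty_val', Matrix.cons_val_fin_one]
  constructor
  · rintro ⟨e, ⟨a00, a01⟩, -, a11⟩
    have he : ω * e = 0 := by linear_combination -(a11 + a00)
    have he0 : e = 0 := (mul_eq_zero.mp he).resolve_left hω0
    exact ⟨by linear_combination a00, by linear_combination a01 + he0⟩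
  · rintro ⟨hz, hw⟩
    refine ⟨0, ⟨?_, ?_⟩, ?_, ?_⟩
    · linear_combination hz
    · linear_combination hw
    · linear_combination ω * hz - hw
    · linear_combination -hz

/-- A non-scalar projective invariant of type `C₅`: `s` itself; so `h⁰(⟨s⟩, pgl₂) = 1`, not `0`.
[folklore] -/
theorem exists_nonscalar_projComm_nonsplitTorus {ω : F} (hω : ω ^ 2 + ω + 1 = 0) :
    ∃ X : Matrix (Fin 2) (Fin 2) F,
      (∃ c : F, !![(0 : F), 1; 1, ω] * X = X * !![(0 : F), 1; 1, ω] + c • !![(0 : F), 1; 1, ω]) ∧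
        ¬ ∃ c : F, X = c • (1 : Matrix (Fin 2) (Fin 2) F) :=
  ⟨!![0, 1; 1, ω], (projComm_nonsplitTorus_iff hω _).2 (by simp),
    not_exists_eq_smul_one (Or.inl (by simp))⟩

/-- **Type `S₃`** (`D̄_v = ⟨u₁, w⟩ = SL₂(𝔽₂)`, `w = !![0,1;1,0]`; block (i), supersingular:
dihedral supercuspidal with cubic `θ/θ^c`).  The joint projective invariants are exactly
`{!![x, y; y, x + y]} = 𝔽₂`-span of `1` and the `3`-cycle `u₁ w` (whose inverse is congruent to
itself modulo scalars in characteristic `2`) — a `2`-dimensional space, so `h⁰(S₃, pgl₂) = 1`.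
[folklore] -/
theorem projComm_sl2F2_iff (X : Matrix (Fin 2) (Fin 2) F) :
    ((∃ c : F, !![(1 : F), 1; 0, 1] * X = X * !![(1 : F), 1; 0, 1] + c • !![(1 : F), 1; 0, 1]) ∧
      (∃ c : F, !![(0 : F), 1; 1, 0] * X = X * !![(0 : F), 1; 1, 0] + c • !![(0 : F), 1; 1, 0])) ↔
      X 1 0 = X 0 1 ∧ X 1 1 = X 0 0 + X 0 1 := by
  have h2 : (2 : F) = 0 := CharTwo.two_eq_zero
  obtain ⟨x, y, z, w, rfl⟩ : ∃ x y z w : F, X = !![x, y; z, w] := ⟨_, _, _, _, Matrix.eta_fin_two X⟩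
  simp only [fin_two_mul_eq_mul_add_smul_iff, Matrix.of_apply, Matrix.cons_val',
    Matrix.cons_val_zero, Matrix.cons_val_one, Matrix.empty_val', Matrix.cons_val_fin_one]
  constructor
  · rintro ⟨⟨e₁, ⟨a00, a01⟩, -, -⟩, ⟨e₂, ⟨f00, -⟩, -, -⟩⟩
    exact ⟨by linear_combination f00, by linear_combination a01 - a00 + f00⟩
  · rintro ⟨hz, hw⟩
    refine ⟨⟨y, ⟨?_, ?_⟩, ?_, ?_⟩, ⟨y, ⟨?_, ?_⟩, ?_, ?_⟩⟩
    · linear_combination hz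
    · linear_combination hw
    · ring
    · linear_combination -hz - y * h2
    · linear_combination hz
    · linear_combination hw
    · linear_combination -hw - y * h2
    · linear_combination -hz

/-- A non-scalar projective invariant of type `S₃`: the `3`-cycle-type matrix `!![0,1;1,1]`; so
`h⁰(S₃, pgl₂) = 1`, not `0` — the supersingular type is obstructed (`R_v^ψ` a hypersurface,
Chenevier / [arXiv:1509.00332, Prop. 2.14]). [folklore] -/
theorem exists_nonscalar_projComm_sl2F2 :
    ∃ X : Matrix (Fin 2) (Fin 2) F,
      ((∃ c : F, !![(1 : F), 1; 0, 1] * X = X * !![(1 : F), 1; 0, 1] + c • !![(1 : F), 1; 0, 1]) ∧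
        (∃ c : F, !![(0 : F), 1; 1, 0] * X = X * !![(0 : F), 1; 1, 0] + c • !![(0 : F), 1; 1, 0])) ∧
        ¬ ∃ c : F, X = c • (1 : Matrix (Fin 2) (Fin 2) F) :=
  ⟨!![0, 1; 1, 1], (projComm_sl2F2_iff _).2 (by simp),
    not_exists_eq_smul_one (Or.inl (by simp))⟩

/-- **Type `A₄`** (`D̄_v = ⟨u₁, u_ω, t⟩ = B(𝔽₄)`, the Borel subgroup of `SL₂(𝔽₄)`; block (ii)
residually, in characteristic `0` the PRIMITIVE tetrahedral type).  The joint projective invariants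
are exactly the SCALARS (`X₀₁ = X₁₀ = 0`, `X₁₁ = X₀₀`), so `h⁰(A₄, pgl₂) = 0 = h²(G_{ℚ₂}, sl₂(σ̄_v))`:
the fixed-determinant framed deformation ring of this type is formally smooth. [folklore] -/
theorem projComm_borel_iff {ω : F} (hω : ω ^ 2 + ω + 1 = 0) (X : Matrix (Fin 2) (Fin 2) F) :
    ((∃ c : F, !![(1 : F), 1; 0, 1] * X = X * !![(1 : F), 1; 0, 1] + c • !![(1 : F), 1; 0, 1]) ∧
      (∃ c : F, !![(1 : F), ω; 0, 1] * X = X * !![(1 : F), ω; 0, 1] + c • !![(1 : F), ω; 0, 1]) ∧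
      (∃ c : F, !![ω, 0; 0, ω + 1] * X = X * !![ω, 0; 0, ω + 1] + c • !![ω, 0; 0, ω + 1])) ↔
      X 0 1 = 0 ∧ X 1 0 = 0 ∧ X 1 1 = X 0 0 := by
  rw [← and_assoc, projComm_kleinFour_iff hω, projComm_splitTorus_iff ω]
  constructor
  · rintro ⟨⟨hz, hw⟩, hy, -⟩
    exact ⟨hy, hz, hw⟩
  · rintro ⟨hy, hz, hw⟩
    exact ⟨⟨hz, hw⟩, hy, hz⟩

/-- **No projective invariants of the `𝔽₄`-Borel on `M₂` (`h⁰(B(𝔽₄), pgl₂) = 0`)** — the first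
lemma of card `two-adic-block-trichotomy` (ideator 6), re-homed.  Over a field `F` of
characteristic `2` with `ω² + ω + 1 = 0`: if a `2 × 2` matrix `X` satisfies `g X = X g + c_g • g` for
the three generators `g ∈ {u₁, u_ω, t}` of the Borel subgroup of `SL₂(𝔽₂(ω))` (i.e. `X` is
invariant modulo scalars under conjugation by `B ≅ A₄`), then `X` is scalar.  This is the vanishing
`H⁰(G_{ℚ₂}, pgl₂(σ̄_v)) = 0`, equivalently `H²(G_{ℚ₂}, sl₂(σ̄_v)) = 0`, for a residual local image of
type `A₄` at `p = 2`. [folklore] -/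
theorem borelF4_projInvariants_scalar {ω : F} (hω : ω ^ 2 + ω + 1 = 0)
    (X : Matrix (Fin 2) (Fin 2) F)
    (h₁ : ∃ c : F, !![(1 : F), 1; 0, 1] * X = X * !![(1 : F), 1; 0, 1] + c • !![(1 : F), 1; 0, 1])
    (h₂ : ∃ c : F, !![(1 : F), ω; 0, 1] * X = X * !![(1 : F), ω; 0, 1] + c • !![(1 : F), ω; 0, 1])
    (h₃ : ∃ c : F, !![ω, 0; 0, ω + 1] * X = X * !![ω, 0; 0, ω + 1] + c • !![ω, 0; 0, ω + 1]) :
    ∃ c : F, X = c • (1 : Matrix (Fin 2) (Fin 2) F) := by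
  obtain ⟨hy, hz, hw⟩ := (projComm_borel_iff hω X).1 ⟨h₁, h₂, h₃⟩
  refine ⟨X 0 0, ?_⟩
  rw [Matrix.eta_fin_two X, hy, hz, hw]
  ext i j
  fin_cases i <;> fin_cases j <;> simp

/-! ### Registered sub-goal: uniqueness of the regular local type -/

/-- **The obstruction table in one statement** (registered sub-goal of stmt-Langlands-15110, line
`SketchIdeator6`).  Over any field of characteristic `2` with `ω² + ω + 1 = 0`: the projective
invariants of the Borel `A₄ = ⟨u₁, u_ω, t⟩` on `M₂` are the scalars (`h⁰(pgl₂) = 0`), while each of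
the other realisable local types `C₂ = ⟨u₁⟩`, `V₄ = ⟨u₁, u_ω⟩`, `C₃ = ⟨t⟩`, `C₅ = ⟨s⟩`,
`S₃ = ⟨u₁, w⟩` has a NON-SCALAR projective invariant (`h⁰(pgl₂) ≥ 1`).  Hence `A₄` is the unique
realisable local type at `v ∣ 2` with unobstructed fixed-determinant framed deformations
(`H²(G_{ℚ₂}, sl₂(σ̄_v)) = 0`); the trivial type is obstructed a fortiori (every matrix is invariant).
[folklore] -/
theorem crux_localObstructionTable : ∀ (F : Type) [Field F] [CharP F 2] (ω : F), ω ^ 2 + ω + 1 = 0 → (∀ X : Matrix (Fin 2) (Fin 2) F, (∃ c : F, !![(1 : F), 1; 0, 1] * X = X * !![(1 : F), 1; 0, 1] + c • !![(1 : F), 1; 0, 1]) → (∃ c : F, !![(1 : F), ω; 0, 1] * X = X * !![(1 : F), ω; 0, 1] + c • !![(1 : F), ω; 0, 1]) → (∃ c : F, !![ω, 0; 0, ω + 1] * X = X * !![ω, 0; 0, ω + 1] + c • !![ω, 0; 0, ω + 1]) → ∃ c : F, X = c • (1 : Matrix (Fin 2) (Fin 2) F)) ∧ (∃ X : Matrix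 (Fin 2) (Fin 2) F, (∃ c : F, !![(1 : F), 1; 0, 1] * X = X * !![(1 : F), 1; 0, 1] + c • !![(1 : F), 1; 0, 1]) ∧ ¬ ∃ c : F, X = c • (1 : Matrix (Fin 2) (Fin 2) F)) ∧ (∃ X : Matrix (Fin 2) (Fin 2) F, ((∃ c : F, !![(1 : F), 1; 0, 1] * X = X * !![(1 : F), 1; 0, 1] + c • !![(1 : F), 1; 0, 1]) ∧ (∃ c : F, !![(1 : F), ω; 0, 1] * X = X * !![(1 : F), ω; 0, 1] + c • !![(1 : F), ω; 0, 1])) ∧ ¬ ∃ c : F, X = c • (1 : Matrix (Fin 2) (Fin 2) F)) ∧ (∃ X : Matrix (Fin 2) (Fin 2) F, (∃ c : F, !![ω, 0; 0, ω + 1] * X = X * !![ω, 0; 0, ω + 1] + c • !![ω, 0; 0, ω + 1]) ∧ ¬ ∃ c : F, X = c • (1 : Matrix (Fin 2) (Fin 2) F)) ∧ (∃ X : Matrix (Fin 2) (Fin 2) F, (∃ c : F, !![(0 : F), 1; 1, ω] * X = X * !![(0 : F), 1; 1, ω] + c • !![(0 : F), 1; 1, ω]) ∧ ¬ ∃ c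 : F, X = c • (1 : Matrix (Fin 2) (Fin 2) F)) ∧ (∃ X : Matrix (Fin 2) (Fin 2) F, ((∃ c : F, !![(1 : F), 1; 0, 1] * X = X * !![(1 : F), 1; 0, 1] + c • !![(1 : F), 1; 0, 1]) ∧ (∃ c : F, !![(0 : F), 1; 1, 0] * X = X * !![(0 : F), 1; 1, 0] + c • !![(0 : F), 1; 1, 0])) ∧ ¬ ∃ c : F, X = c • (1 : Matrix (Fin 2) (Fin 2) F)) := by
  intro F _ _ ω hω
  exact ⟨fun X h₁ h₂ h₃ => borelF4_projInvariants_scalar hω X h₁ h₂ h₃,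
    exists_nonscalar_projComm_unipotent, exists_nonscalar_projComm_kleinFour hω,
    exists_nonscalar_projComm_splitTorus ω, exists_nonscalar_projComm_nonsplitTorus hω,
    exists_nonscalar_projComm_sl2F2⟩

end LocalObstructionTable

end Summit.Langlands.Langlands.Theorems.TwoAdicBianchiProModularityLevel
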